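import Summits.QuantumAdvantage.AdviceFreeQNC0.CubeCoverSetup
import HarnessLib

/-!
# Cell qa-qnc0 (rung F-Q1, route RingFrame, crux α, line `product`): the two equidistribution counts
# behind `CubeCover`

Planner qa-qnc0-p1's T6(b) (HOME/qa-qnc0-p1/ROUND-8.md §1(b)), quantitative core.  With `M = 2^{D+1} − 1`:

* `three_pow_mul_card_goodCfg_ge` (ONE base point): for every `x` and `r`, the number `N` of
  generator matrices all of whose `M` positive vertices `x + a_S` lie in class `r` satisfies
  `3^M·N ≥ 2^{(D+1)L}·(1 − 3^M (1 − 2^{−D−1})^L)` — every non-trivial character of `(ℤ/3)^M` loses a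
  factor `1 − 2^{−D−1}` in EVERY column (`nonconst_one`: the Walsh matrix mod 3,
  `exists_subsetParSum_ne_zero`).
* `three_pow_mul_count_pin_le` (TWO base points, generator `i` frozen to `x ⊕ y`): if `x` and `y`
  agree in `≥ m₀` and differ in `≥ m₀` columns, the pinned count `P` satisfies
  `3^{M−1}·P ≤ 2^{DL}·(1 + 3^{M−1}(1 − 2^{−D})^{m₀})` — a non-trivial character `(ξˣ, ξʸ)` loses a factor
  in every agreeing column if `ξˣ + ξʸ ≠ 0` and in every differing column if `ξˣ − ξʸ ≠ 0`
  (`nonconst_two`); `count_pin_le_pow`: `P ≤ 2^{DL}` always.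

The phase algebra: `phase_cast` (`ω`-phase mod 3 = constant + twisted parity sum
`Σ_j ±ξ_j [⟨1_{R_j}, α⟩ = 1]`), `exists_zbitSum_ne_zero` (subtype-indexed Walsh lemma).
WHAT THIS IS NOT: the union bound / tail / assembly are in `CubeCover.lean`; nothing on `FSB`/α.
[folklore]
-/

noncomputable section

namespace Summit.QuantumAdvantage.AdviceFreeQNC0

namespace CubeChar

open Finset

variable {L D : ℕ}

/-! ### Phases mod 3 -/

/-- `{0,1} ↪ ℤ/3`. -/
def zbit (b : Bool) : ZMod 3 := if b = true then 1 else 0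

/-- `(−1)^b ∈ ℤ/3`. -/
def sgnb (b : Bool) : ZMod 3 := if b = true then -1 else 1

/-- `[u ⊕ v] = [u] + (−1)^u [v]` in `ℤ/3`. -/
theorem zbit_xor (u v : Bool) : zbit (xor u v) = zbit u + sgnb u * zbit v := by
  cases u <;> cases v <;> decide

/-- `(−1)^b` is a unit. -/
theorem sgnb_ne_zero (b : Bool) : sgnb b ≠ 0 := by cases b <;> decide

/-- `(−1)^b · (−1)^b = 1`. -/
theorem sgnb_mul_self (b : Bool) : sgnb b * sgnb b = 1 := by cases b <;> decide

section Phase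

variable {G : Type*} {V : Type*} [Fintype V]

/-- The `ω`-phase mod 3 is a constant plus a twisted parity sum. -/
theorem phase_cast (c : V → Fin L → Bool) (φ : V → G → Bool) (ξ : V → ZMod 3) (ℓ : Fin L) (α : G) :
    ((phase c φ ξ ℓ α : ℕ) : ZMod 3) =
      (∑ j, ξ j * zbit (c j ℓ)) + ∑ j, sgnb (c j ℓ) * ξ j * zbit (φ j α) := by
  unfold phase
  push_cast
  rw [← Finset.sum_add_distrib]
  refine Finset.sum_congr rfl fun j _ => ?_
  rw [ZMod.natCast_zmod_val]
  have e : (if xor (c j ℓ) (φ j α) = true then (1 : ZMod 3) else 0) = zbit (xor (c j ℓ) (φ j α)) := rfl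
  rw [e, zbit_xor]
  ring

/-- Different twisted parity sums give different phases mod 3. -/
theorem phase_mod_ne_of (c : V → Fin L → Bool) (φ : V → G → Bool) (ξ : V → ZMod 3) (ℓ : Fin L)
    {α β : G} (h : ∑ j, sgnb (c j ℓ) * ξ j * zbit (φ j α) ≠ ∑ j, sgnb (c j ℓ) * ξ j * zbit (φ j β)) :
    phase c φ ξ ℓ α % 3 ≠ phase c φ ξ ℓ β % 3 := by
  intro heq
  apply h
  have h3 := (ZMod.natCast_eq_natCast_iff' (phase c φ ξ ℓ α) (phase c φ ξ ℓ β) 3).2 heq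
  rw [phase_cast, phase_cast] at h3
  exact add_left_cancel h3

end Phase

/-! ### The Walsh lemma for subtype-indexed coefficients -/

section Walsh

variable {ι : Type*} [Fintype ι] [DecidableEq ι]

omit [DecidableEq ι] in
/-- Re-indexing a subtype-indexed parity sum as a sum over the subsets. -/
theorem sum_subtype_zbit_eq (p : Finset ι → Prop) [DecidablePred p] (ζ : {R // p R} → ZMod 3)
    (α : ι → Bool) :
    ∑ w : {R // p R}, ζ w * zbit (subsetPar w.1 α) =
      ∑ R ∈ (univ : Finset (Finset ι)).filter p,
        if subsetPar R α = true then (if h : p R then ζ ⟨R, h⟩ else 0) else 0 := by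
  rw [Finset.sum_subtype ((univ : Finset (Finset ι)).filter p) (p := p) (fun R => by simp)]
  refine Finset.sum_congr rfl fun w _ => ?_
  rw [dif_pos w.2]
  unfold zbit
  split_ifs <;> simp

/-- **Walsh lemma, subtype form**: a nonzero coefficient vector on a family of nonempty subsets has a
non-vanishing parity sum at some point of the cube. -/
theorem exists_zbitSum_ne_zero (p : Finset ι → Prop) [DecidablePred p] (hp : ∀ R, p R → R.Nonempty)
    (ζ : {R // p R} → ZMod 3) (hζ : ζ ≠ 0) :
    ∃ α : ι → Bool, ∑ w : {R // p R}, ζ w * zbit (subsetPar w.1 α) ≠ 0 := by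
  obtain ⟨w₀, hw₀⟩ := Function.ne_iff.1 hζ
  obtain ⟨α, hα⟩ := exists_subsetParSum_ne_zero p hp (fun R => if h : p R then ζ ⟨R, h⟩ else 0)
    w₀.2 (by rw [dif_pos w₀.2]; exact hw₀)
  exact ⟨α, by rw [sum_subtype_zbit_eq]; exact hα⟩

end Walsh

/-! ### One base point: every column cancels -/

/-- **Non-constancy, one base point.** For a non-trivial character of the positive vertices, the
phase is non-constant in every column. -/
theorem nonconst_one (x : Fin L → Bool) (ξ : PosSub D → ZMod 3) (hξ : ξ ≠ 0) (ℓ : Fin L) :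
    ∃ α ∈ dom1 L D ℓ, ∃ β ∈ dom1 L D ℓ,
      phase (base1 x) (read1 D) ξ ℓ α % 3 ≠ phase (base1 x) (read1 D) ξ ℓ β % 3 := by
  obtain ⟨α, hα⟩ := exists_zbitSum_ne_zero (fun S : Finset (Fin (D + 1)) => S.Nonempty)
    (fun _ h => h) ξ hξ
  refine ⟨α, Finset.mem_univ _, fun _ => false, Finset.mem_univ _, phase_mod_ne_of _ _ _ _ ?_⟩
  have hR : ∑ j : PosSub D, sgnb (base1 x j ℓ) * ξ j * zbit (read1 D j fun _ => false) = 0 := by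
    refine Finset.sum_eq_zero fun j _ => ?_
    simp [read1, zbit]
  have hL : ∑ j : PosSub D, sgnb (base1 x j ℓ) * ξ j * zbit (read1 D j α) =
      sgnb (x ℓ) * ∑ j : PosSub D, ξ j * zbit (subsetPar j.1 α) := by
    rw [Finset.mul_sum]
    refine Finset.sum_congr rfl fun j _ => ?_
    simp only [base1, read1]
    ring
  rw [hL, hR]
  exact mul_ne_zero (sgnb_ne_zero _) hα

/-- **The one-base-point count.** `3^M·#goodCfg ≥ 2^{(D+1)L}(1 − 3^M(1 − 2^{−D−1})^L)`. -/
theorem three_pow_mul_card_goodCfg_ge (x : Fin L → Bool) (r : ℕ) :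
    (2 : ℝ) ^ ((D + 1) * L) * (1 - (3 : ℝ) ^ (2 ^ (D + 1) - 1) * (1 - 1 / (2 : ℝ) ^ (D + 1)) ^ L) ≤
      (3 : ℝ) ^ (2 ^ (D + 1) - 1) * ((goodCfg D x r).card : ℝ) := by
  classical
  have hK : ∀ ℓ, (dom1 L D ℓ).card = 2 ^ (D + 1) := card_dom1
  have hm : ∀ ξ : PosSub D → ZMod 3, ξ ≠ 0 → L ≤ (univ.filter fun ℓ : Fin L =>
      ∃ α ∈ dom1 L D ℓ, ∃ β ∈ dom1 L D ℓ,
        phase (base1 x) (read1 D) ξ ℓ α % 3 ≠ phase (base1 x) (read1 D) ξ ℓ β % 3).card := by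
    intro ξ hξ
    rw [Finset.filter_true_of_mem fun ℓ _ => nonconst_one x ξ hξ ℓ, Finset.card_univ, Fintype.card_fin]
  have h := abs_three_pow_mul_count_sub_le_uniform (base1 x) (read1 D) (dom1 L D) r hK
    (by positivity) hm
  rw [card_posSub, ← card_goodCfg_eq_count] at h
  have hKL : (((2 ^ (D + 1) : ℕ) : ℝ)) ^ L = (2 : ℝ) ^ ((D + 1) * L) := by push_cast; rw [← pow_mul]
  have hq : (1 : ℝ) - 1 / ((2 ^ (D + 1) : ℕ) : ℝ) = 1 - 1 / (2 : ℝ) ^ (D + 1) := by push_cast; rfl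
  rw [hKL, hq] at h
  rw [abs_le] at h
  linarith [h.1]

/-! ### Two base points: agreeing or differing columns cancel -/

/-- **Non-constancy, two base points.** In column `ℓ`, a character `(ξˣ, ξʸ)` has non-constant phase
on the frozen-bit domain if `x ℓ = y ℓ` and `ξˣ + ξʸ ≠ 0`, or if `x ℓ ≠ y ℓ` and `ξˣ − ξʸ ≠ 0`. -/
theorem nonconst_two (x y z : Fin L → Bool) (i : Fin (D + 1)) (ξ : Bool × FreeSub D i → ZMod 3)
    (ℓ : Fin L)
    (hcase : (x ℓ = y ℓ ∧ (fun R : FreeSub D i => ξ (false, R) + ξ (true, R)) ≠ 0) ∨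
      (x ℓ ≠ y ℓ ∧ (fun R : FreeSub D i => ξ (false, R) - ξ (true, R)) ≠ 0)) :
    ∃ α ∈ dom2 i z ℓ, ∃ β ∈ dom2 i z ℓ,
      phase (base2 x y) read2 ξ ℓ α % 3 ≠ phase (base2 x y) read2 ξ ℓ β % 3 := by
  classical
  set ζ : FreeSub D i → ZMod 3 := fun R => sgnb (x ℓ) * ξ (false, R) + sgnb (y ℓ) * ξ (true, R)
    with hζdef
  have hζ : ζ ≠ 0 := by
    rcases hcase with ⟨hxy, hne⟩ | ⟨hxy, hne⟩
    · intro h0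
      apply hne
      funext R
      have hR := congrFun h0 R
      simp only [hζdef, hxy, Pi.zero_apply] at hR ⊢
      have : sgnb (y ℓ) * (sgnb (y ℓ) * ξ (false, R) + sgnb (y ℓ) * ξ (true, R)) = 0 := by
        rw [hR, mul_zero]
      rw [mul_add, ← mul_assoc, ← mul_assoc, sgnb_mul_self, one_mul, one_mul] at this
      exact this
    · intro h0
      apply hne
      funext R
      have hR := congrFun h0 R
      have hs : sgnb (y ℓ) = -sgnb (x ℓ) := by
        revert hxy; cases x ℓ <;> cases y ℓ <;> decide
      simp only [hζdef, hs, Pi.zero_apply] at hR ⊢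
      have : sgnb (x ℓ) * (sgnb (x ℓ) * ξ (false, R) + -sgnb (x ℓ) * ξ (true, R)) = 0 := by
        rw [hR, mul_zero]
      rw [mul_add, ← mul_assoc, sgnb_mul_self, one_mul, neg_mul, mul_neg, ← mul_assoc, sgnb_mul_self,
        one_mul, ← sub_eq_add_neg] at this
      exact this
  obtain ⟨α₀, hα₀⟩ := exists_zbitSum_ne_zero (fun R : Finset (Fin (D + 1)) => R.Nonempty ∧ i ∉ R)
    (fun _ h => h.1) ζ hζ
  -- the twisted parity sum of the family equals the parity sum of `ζ`, and ignores bit `i`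
  have htw : ∀ γ : Fin (D + 1) → Bool,
      ∑ j : Bool × FreeSub D i, sgnb (base2 x y j ℓ) * ξ j * zbit (read2 j γ) =
        ∑ R : FreeSub D i, ζ R * zbit (subsetPar R.1 γ) := by
    intro γ
    rw [Fintype.sum_prod_type, Fintype.sum_bool, ← Finset.sum_add_distrib]
    refine Finset.sum_congr rfl fun R _ => ?_
    simp only [base2, read2, hζdef, cond_true, cond_false]
    ring
  refine ⟨Function.update α₀ i (z ℓ), ?_, Function.update (fun _ => false) i (z ℓ), ?_,
    phase_mod_ne_of _ _ _ _ ?_⟩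
  · unfold dom2; rw [Finset.mem_filter]; exact ⟨Finset.mem_univ _, Function.update_self _ _ _⟩
  · unfold dom2; rw [Finset.mem_filter]; exact ⟨Finset.mem_univ _, Function.update_self _ _ _⟩
  rw [htw, htw]
  have h1 : ∑ R : FreeSub D i, ζ R * zbit (subsetPar R.1 (Function.update α₀ i (z ℓ))) =
      ∑ R : FreeSub D i, ζ R * zbit (subsetPar R.1 α₀) :=
    Finset.sum_congr rfl fun R _ => by rw [subsetPar_update_of_notMem R.2.2]
  have h2 : ∑ R : FreeSub D i, ζ R * zbit (subsetPar R.1 (Function.update (fun _ => false) i (z ℓ))) = 0 := by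
    refine Finset.sum_eq_zero fun R _ => ?_
    rw [subsetPar_update_of_notMem R.2.2, subsetPar_zero]
    simp [zbit]
  rw [h1, h2]
  exact hα₀

/-- A non-trivial two-base-point character has `ξˣ + ξʸ ≠ 0` or `ξˣ − ξʸ ≠ 0`. -/
theorem sum_ne_zero_or_sub_ne_zero {i : Fin (D + 1)} (ξ : Bool × FreeSub D i → ZMod 3) (hξ : ξ ≠ 0) :
    (fun R : FreeSub D i => ξ (false, R) + ξ (true, R)) ≠ 0 ∨
      (fun R : FreeSub D i => ξ (false, R) - ξ (true, R)) ≠ 0 := by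
  by_contra h
  push Not at h
  obtain ⟨h1, h2⟩ := h
  apply hξ
  funext ⟨b, R⟩
  have e1 := congrFun h1 R
  have e2 := congrFun h2 R
  simp only [Pi.zero_apply] at e1 e2
  have hf : ξ (false, R) = 0 := by
    have h3 : (2 : ZMod 3) * ξ (false, R) = 0 := by
      linear_combination e1 + e2
    have h4 : (2 : ZMod 3) * 2 = 1 := by decide
    calc ξ (false, R) = (2 : ZMod 3) * 2 * ξ (false, R) := by rw [h4, one_mul]
      _ = 0 := by rw [mul_assoc, h3, mul_zero]
  cases b
  · exact hf
  · rw [hf, zero_add] at e1; exact e1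

/-- **The two-base-point count.** If `x` and `y` differ in `≥ m₀` and agree in `≥ m₀` columns, the
pinned count satisfies `3^{M−1}·P ≤ 2^{DL}·(1 + 3^{M−1}(1 − 2^{−D})^{m₀})`. -/
theorem three_pow_mul_count_pin_le (x y : Fin L → Bool) (i : Fin (D + 1)) (r m₀ : ℕ)
    (hne : m₀ ≤ (univ.filter fun ℓ : Fin L => x ℓ ≠ y ℓ).card)
    (heq : m₀ ≤ (univ.filter fun ℓ : Fin L => x ℓ = y ℓ).card) :
    (3 : ℝ) ^ (2 ^ (D + 1) - 2) *
        (count (base2 (i := i) x y) read2 (dom2 i fun ℓ => xor (x ℓ) (y ℓ)) r : ℝ) ≤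
      (2 : ℝ) ^ (D * L) * (1 + (3 : ℝ) ^ (2 ^ (D + 1) - 2) * (1 - 1 / (2 : ℝ) ^ D) ^ m₀) := by
  classical
  set z : Fin L → Bool := fun ℓ => xor (x ℓ) (y ℓ) with hz
  have hK : ∀ ℓ, (dom2 i z ℓ).card = 2 ^ D := card_dom2 i z
  have hm : ∀ ξ : Bool × FreeSub D i → ZMod 3, ξ ≠ 0 → m₀ ≤ (univ.filter fun ℓ : Fin L =>
      ∃ α ∈ dom2 i z ℓ, ∃ β ∈ dom2 i z ℓ,
        phase (base2 x y) read2 ξ ℓ α % 3 ≠ phase (base2 x y) read2 ξ ℓ β % 3).card := by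
    intro ξ hξ
    rcases sum_ne_zero_or_sub_ne_zero ξ hξ with h | h
    · refine heq.trans (Finset.card_le_card fun ℓ hℓ => ?_)
      rw [Finset.mem_filter] at hℓ ⊢
      exact ⟨Finset.mem_univ _, nonconst_two x y z i ξ ℓ (Or.inl ⟨hℓ.2, h⟩)⟩
    · refine hne.trans (Finset.card_le_card fun ℓ hℓ => ?_)
      rw [Finset.mem_filter] at hℓ ⊢
      exact ⟨Finset.mem_univ _, nonconst_two x y z i ξ ℓ (Or.inr ⟨hℓ.2, h⟩)⟩
  have hDpos : 0 < 2 ^ D := Nat.two_pow_pos D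
  have h := abs_three_pow_mul_count_sub_le_uniform (base2 x y) read2 (dom2 i z) r hK hDpos hm
  rw [card_bool_prod_freeSub] at h
  have hKL : (((2 ^ D : ℕ) : ℝ)) ^ L = (2 : ℝ) ^ (D * L) := by push_cast; rw [← pow_mul]
  have hq : (1 : ℝ) - 1 / ((2 ^ D : ℕ) : ℝ) = 1 - 1 / (2 : ℝ) ^ D := by push_cast; rfl
  rw [hKL, hq] at h
  rw [abs_le] at h
  linarith [h.2]

/-- The trivial bound on the pinned count: `P ≤ 2^{DL}`. -/
theorem count_pin_le_pow (x y z : Fin L → Bool) (i : Fin (D + 1)) (r : ℕ) :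
    (count (base2 (i := i) x y) read2 (dom2 i z) r : ℝ) ≤ (2 : ℝ) ^ (D * L) := by
  classical
  have h : count (base2 (i := i) x y) read2 (dom2 i z) r ≤ 2 ^ (D * L) := by
    unfold count
    refine (Finset.card_filter_le _ _).trans ?_
    rw [Fintype.card_piFinset, Finset.prod_congr rfl fun ℓ _ => card_dom2 i z ℓ, Finset.prod_const,
      Finset.card_univ, Fintype.card_fin, ← pow_mul]
  exact_mod_cast h

end CubeChar

end Summit.QuantumAdvantage.AdviceFreeQNC0

end
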